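import Summits.ResolutionOfSingularities.ResolutionOfSingularities.Theorems.FrobeniusClosingPatchingRelPerfectDepthOneTargetsDefs
import Summits.ResolutionOfSingularities.ResolutionOfSingularities.Theorems.FrobeniusClosingPatchingRelPerfectTowerContraction

/-!
# Chain W5.2 — r-d1 target D5 `DepthOneTargets.TowerContraction` HOLDS, BY NAME

[OURS · L1 W5.2] One-line closure of plan-1's typed target D5 (`ChainW52TargetsE.lean` 9d67ec503d849faa, now the tree
module `…FrobeniusClosingPatchingRelPerfectDepthOneTargetsDefs.lean`, p496180) by res-L1-w52-stub-3's content proof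
`towerContraction` (`…FrobeniusClosingPatchingRelPerfectTowerContraction.lean`, p493249; identical binder shape): if
`g : X ⟶ Spec S` is a blowing up along an ideal sheaf cosupported in the closed point of the regular local `S`, `X` is
regular and `I𝒪_X` is locally principal (`I ≠ 0`), then `I` has an `𝔪`-primary-or-unit companion `Q` with a regular
blowing up along `(I·Q)~` (Stacks 080A/080B). Filed by res-D-pv-009 for the DONE seat res-L1-w52-stub-3 (its STATUS
2026-08-27T03:52:25Z names exactly this one-liner); crux `PatchingRelPerfect`, item stmt-ResolutionOfSingularities-16161,
`--as helper`. NOT a statement of the manuscript under review; nothing of it is used.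

## References
* The Stacks Project, Tags 080A, 080B. [StacksProject]
-/

noncomputable section

open CategoryTheory AlgebraicGeometry
open Literature.AlgebraicGeometry.Resolution

set_option linter.dupNamespace false

namespace Summit.ResolutionOfSingularities.ResolutionOfSingularities.Theorems.DepthOneTargets

universe u

/-- **D5 `TowerContraction` HOLDS** (by name): plan-1's typed target, closed by res-L1-w52-stub-3's
`towerContraction` (p493249) — same binders, same conclusion. [cite: StacksProject, Tag 080A]
[cite: StacksProject, Tag 080B] -/
theorem towerContraction_holds : TowerContraction.{u} :=
  fun S _ _ I hI X g K hg hK hX hIp => towerContraction (S := S) I hI X g K hg hK hX hIp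

end Summit.ResolutionOfSingularities.ResolutionOfSingularities.Theorems.DepthOneTargets

end
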